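import Summits.ABC.IUTFork.ForkInd1
import Literature.IUT.LogVolume.Theorem110MinVariant
import HarnessLib

/-!
# The fork at [IUTchIII] Corollary 3.12, XXIIb: the (Ind1) readings of XXII ARE campaign S's Step (v) quantities

Record-only file (D-0012) of the abc-iut cell's fork skeleton (seat abc-iut-skel); TAKES NO SIDE. Skeleton
XXII (`ForkInd1`) types the two readings of (Ind1) at [IUTchIV] Thm. 1.10 Step (v) over abstract data
(places `E`, weights `λ`, gains `c`); campaign S (seat abc-iut-S3) carries the same Step (v) bookkeeping
over its per-`v_ℚ` proof data `Thm110Local.DstLocal` (`Theorem110LocalBounds`, p403939/p407681) and — for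
the planner's call R2 of the STEPV-IND1-NOTE — the `λ_min` variant `Theorem110MinVariant` (p407418:
`DstLocal.minAvg`, `minAvg_le_avg`, `minAvg_eq_of_const`, `minAvg_le_geometric`, `thm110MinVariant_holds`).
This file records, by `rfl` and one-line rewrites, that the two vocabularies name THE SAME numbers for a
datum `D : DstLocal E` with gains `c = D.logQ` (`log(q_v)`, the asymmetric term before the factor `j²/2l`):

* `aggregate_eq_wavg`: XXII's weighted aggregate over collections IS S3's `DstLocal.wavg` (Prop. 1.7 weights);
* `gainMin_eq_tupleMin`, `aggregate_gainMin_eq_minAvg`: reading (U)'s per-collection least gain and its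
  aggregate ARE S3's `tupleMin` and `minAvg` (the `m_j` of abc-iut-c312-d1's note);
* `aggregate_gainAt_eq_avg`, `aggregate_gainSymm_eq_avg`: reading (S)'s aggregates (distinguished slot /
  symmetrised) ARE S3's `DstLocal.avg D.logQ` = the text's `log(q_{v_ℚ})` ([IUTchIV] Def. 1.9 (ii); Step (v)
  display p. 28);
* `fork_dstLocal`: the fork of XXII in campaign S's terms — (S) = `D.avg D.logQ`, (U) = `D.minAvg j` — with the
  inequality clause supplied by S3's `minAvg_le_avg` (= XXII's `aggregate_gainMin_le` at `c = log(q_v)`).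

So a referee can move between the skeleton's statement of the (Ind1) question (locators in XXII), S3's
Thm-1.10-level consequences (what survives of the display under (U): `Thm110MinVariant`) and c312-d1's
real-packet lower bound (`MultiradialRegionInd1Bound`) without re-deriving anything. [claim: Mochizuki2012,
status: disputed] ([IUTchIV] Prop. 1.7 p. 16, Thm. 1.10 Step (v) pp. 27–28) Deliberately NOT here: any judgement.
-/

noncomputable section

namespace Summit.ABC.IUTFork.Ind1StepV

open Literature.IUT.LogVolume.Thm110Local Literature.Algebra.PolynomialIdentities.WeightedAverage

variable {E : Type} [Fintype E] [Nonempty E] (D : DstLocal E)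

omit [Nonempty E] in
/-- XXII's weighted aggregate over `(n+1)`-collections IS S3's `DstLocal.wavg (n+1)` (same weights
`λ_Πe⃗`, same quotient). [folklore] -/
theorem aggregate_eq_wavg (n : ℕ) (g : (Fin (n + 1) → E) → ℝ) : aggregate D.lam g = D.wavg (n + 1) g := rfl

omit [Fintype E] [Nonempty E] in
/-- Reading (U)'s least slot gain IS S3's `tupleMin`. [folklore] -/
theorem gainMin_eq_tupleMin (f : E → ℝ) {n : ℕ} (e : Fin (n + 1) → E) :
    gainMin f e = DstLocal.tupleMin f e := rfl

omit [Nonempty E] in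
/-- **Reading (U) in campaign S's terms**: the (U)-aggregate of the gains `log(q_v)` IS S3's `minAvg`
(`m_n`, the `λ`-weighted average over collections of `min_k log(q_{e_k})`). [folklore] -/
theorem aggregate_gainMin_eq_minAvg (n : ℕ) : aggregate D.lam (gainMin (m := n) D.logQ) = D.minAvg n := rfl

/-- **Reading (S) in campaign S's terms**: the distinguished-slot aggregate of the gains `log(q_v)` IS
S3's `D.avg D.logQ` = the text's `log(q_{v_ℚ})`. [folklore] -/
theorem aggregate_gainAt_eq_avg (n : ℕ) (i : Fin (n + 1)) :
    aggregate D.lam (gainAt D.logQ i) = D.avg D.logQ :=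
  aggregate_gainAt D.logQ D.lam_pos i

/-- … and so is the symmetrised aggregate ("symmetrizing … does not affect", Prop. 1.7). [folklore] -/
theorem aggregate_gainSymm_eq_avg (n : ℕ) : aggregate D.lam (gainSymm (m := n) D.logQ) = D.avg D.logQ :=
  aggregate_gainSymm D.logQ D.lam_pos

/-- **The fork of XXII, stated on S3's proof data**: (S) = `D.avg D.logQ` (both ways), (U) = `D.minAvg n ≤` it,
with equality when `log(q_v)` is constant on `E_{v_ℚ}`. [claim: Mochizuki2012, status: disputed] -/
theorem fork_dstLocal (n : ℕ) (i : Fin (n + 1)) :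
    aggregate D.lam (gainAt D.logQ i) = D.avg D.logQ ∧
      aggregate D.lam (gainSymm (m := n) D.logQ) = D.avg D.logQ ∧
      aggregate D.lam (gainMin (m := n) D.logQ) = D.minAvg n ∧ D.minAvg n ≤ D.avg D.logQ ∧
      ((∀ v v', D.logQ v = D.logQ v') → D.minAvg n = D.avg D.logQ) := by
  -- the inequality clause is S3's `DstLocal.minAvg_le_avg` (= XXII's `aggregate_gainMin_le` at `c = log(q_v)`)
  refine ⟨aggregate_gainAt_eq_avg D n i, aggregate_gainSymm_eq_avg D n, rfl, D.minAvg_le_avg n, fun h => ?_⟩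
  rw [← aggregate_gainMin_eq_minAvg]
  exact aggregate_gainMin_eq_of_const h D.lam_pos

end Summit.ABC.IUTFork.Ind1StepV

end
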